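import Literature.IUT.HodgeTheaters.PMBaseDischarge
import Literature.IUT.HodgeTheaters.PMBaseBridgePropsProofs

/-!
# Proofs over [IUTchI] Example 6.3 / Props 6.6 (ii), 6.8 (i): translations act on `𝒟-Θ^{ell}`-bridges

Mochizuki, *Inter-universal Teichmüller theory I*, §6, Example 6.3 (i), (ii) pp. 160–161, Proposition
6.6 (ii) p. 165, Proposition 6.8 (i) pp. 167–168, kurims manuscript (May 2020). PROOF-ONLY companion
(theorems, no definitions) to abc-iut-L5-t4's `PMBaseBridgeProps.lean` / `PMBaseProcessions.lean`, by
the L5 discharge seat abc-iut-L5-t13.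

The POSITIVE part of the `𝔽_l^{⋊±}`-symmetry of `𝒟-Θ^{ell}`-bridges is pure group theory in
`Aut_±(𝒟^{⊚±}) ⊇ Aut_csp(𝒟^{⊚±})` over the interface (lifts of translations compose:
`lifts(z) · lifts(c) = lifts(z + c)`), and is PROVED here:

* for any two `𝒟-Θ^{ell}`-bridges, exhibited by `(ι₁, α₁, β₁)`, `(ι₂, α₂, β₂)`, and any `c ∈ 𝔽_l`, an
  ISOMORPHISM with index bijection `ι₂ ∘ (· + c) ∘ ι₁⁻¹` (`DThetaEllBridge.Iso.exists_transl`);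
* hence **Prop 6.6 (ii), first clause**: isomorphisms between any two `𝒟-Θ^{ell}`-bridges EXIST
  (`DThetaEllBridge.isoTorsor_nonempty`), and **Prop 6.8 (i), transitivity clause**: the automorphisms of the
  underlying `𝒟-Θ^{ell}`-bridge of a `𝒟-Θ^{±ell}`-Hodge theater act TRANSITIVELY on the index set `T`
  (`DThetaPMEllHT.ellBridgeSymmetry_transitive` = the first conjunct of the named statement
  `EllBridgeSymmetry`).

The NEGATIVE elements (`z ↦ −z + c`), hence the count `|Isos| = 2·|T|` of Prop 6.8 (i) and the
surjectivity half of Prop 6.6 (ii), additionally require the compatibility of `φ^{Θell}_{•,v}` with a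
negative automorphism of `𝒟_v` (Example 6.3 (ii) "one verifies immediately that `φ^{Θell}_±` is
equivariant"), which the interface `PMBaseKit` does not carry; they are not asserted here.
Record only; [claim: Mochizuki2012, status: disputed]; nothing here takes a side on any disputed step.
-/

namespace Literature.IUT.HodgeTheaters

open CategoryTheory

universe u

/-! ### Torsor charts and the inverse of an exhibiting index bijection -/

namespace FlPMTorsor

variable {l : ℕ} {T : Type*} (S : FlPMTorsor l T)

/-- If `ι : 𝔽_l ⥲ T` is an isomorphism of `𝔽_l^±`-torsors (from the tautological structure), then so is
`ι⁻¹`: tautological charts pull back along `ι⁻¹` to charts of `T`. [claim: Mochizuki2012, status: disputed] -/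
theorem symm_trans_mem_of_compat {ι : ZMod l ≃ T}
    (hι : ∀ e ∈ S.charts, ι.trans e ∈ (FlPMTorsor.tautological l).charts) {e₀ : ZMod l ≃ ZMod l}
    (he₀ : e₀ ∈ (FlPMTorsor.tautological l).charts) : ι.symm.trans e₀ ∈ S.charts := by
  obtain ⟨e₁, he₁⟩ := S.nonempty
  obtain ⟨g₁, hg₁⟩ := hι e₁ he₁
  obtain ⟨g₀, rfl⟩ := he₀
  have h : ι.symm.trans (FlPM.toPerm l g₀) = e₁.trans (FlPM.toPerm l (g₀ * g₁⁻¹)) := by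
    ext t
    have ht := congrArg (fun f : ZMod l ≃ ZMod l => f (ι.symm t)) hg₁
    simp only [Equiv.trans_apply, Equiv.apply_symm_apply, FlPM.toPerm_apply] at ht
    simp only [Equiv.trans_apply, FlPM.toPerm_apply, mul_smul, ← ht, inv_smul_smul]
  rw [h]
  exact S.trans_toPerm_mem he₁ _

/-- Translation by `c` is an automorphism of the tautological `𝔽_l^±`-torsor `𝔽_l`.
[claim: Mochizuki2012, status: disputed] -/
theorem addRight_trans_mem_tautological (c : ZMod l) {e : ZMod l ≃ ZMod l}
    (he : e ∈ (FlPMTorsor.tautological l).charts) :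
    (Equiv.addRight c).trans e ∈ (FlPMTorsor.tautological l).charts := by
  obtain ⟨g, rfl⟩ := he
  refine ⟨g * FlPM.transl c, ?_⟩
  ext z
  simp

end FlPMTorsor

namespace PMBaseKit

variable {l : ℕ} {K : PMBaseKit.{u} l}

/-! ### Lifts of translations compose ([IUTchI] Ex 6.3 (i) p. 161) -/

/-- `LabCusp^±` of an inverse isomorphism of global objects is the inverse bijection.
[claim: Mochizuki2012, status: disputed] -/
theorem gLabMap_symm {G H : K.Glob} (φ : G ≅ H) : K.gLabMap φ.symm = (K.gLabMap φ).symm := by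
  have h := K.gLabMap_trans φ φ.symm
  rw [Iso.self_symm_id, K.gLabMap_refl] at h
  ext y
  have h' := congrArg (fun e => e ((K.gLabMap φ).symm y)) h
  simpa using h'.symm

namespace Ex63

/-- `lifts(g₀) · lifts(g) ⊆ lifts(g · g₀)`: composites of lifts are lifts of the product (the poly-action
of `𝔽_l^{⋊±}` on `𝒟^{⊚±}` is an action). [claim: Mochizuki2012, status: disputed] -/
theorem trans_mem_lifts {g₀ g : FlPM l} {b₀ b : Aut K.gModel} (hb₀ : b₀ ∈ lifts K g₀) (hb : b ∈ lifts K g) :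
    b₀ ≪≫ b ∈ lifts K (g * g₀) := by
  refine ⟨?_, ?_⟩
  · have h := (K.autPMg K.gModel).mul_mem hb.1 hb₀.1
    rwa [Aut.Aut_mul_def] at h
  · rw [K.gLabMap_trans, hb₀.2, hb.2]
    ext x
    simp

/-- An element of `Aut_csp(𝒟^{⊚±})` post-composed to a lift is still a lift (lifts are `Aut_csp`-cosets).
[claim: Mochizuki2012, status: disputed] -/
theorem trans_csp_mem_lifts {g : FlPM l} {b c : Aut K.gModel} (hb : b ∈ lifts K g)
    (hc : c ∈ K.autCsp K.gModel) : b ≪≫ c ∈ lifts K g := by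
  refine ⟨?_, ?_⟩
  · have h := (K.autPMg K.gModel).mul_mem (K.autCsp_le_autPMg _ hc) hb.1
    rwa [Aut.Aut_mul_def] at h
  · rw [K.gLabMap_trans, hb.2, show K.gLabMap c = Equiv.refl _ from MonoidHom.mem_ker.mp hc,
      Equiv.trans_refl]

/-- The inverse of a lift of `g` is a lift of `g⁻¹`. [claim: Mochizuki2012, status: disputed] -/
theorem symm_mem_lifts {g : FlPM l} {b : Aut K.gModel} (hb : b ∈ lifts K g) : b.symm ∈ lifts K g⁻¹ := by
  refine ⟨?_, ?_⟩
  · have h := (K.autPMg K.gModel).inv_mem hb.1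
    rwa [Aut.Aut_inv_def] at h
  · rw [gLabMap_symm, hb.2]
    ext x
    simp

/-- Lifts exist for every `g ∈ 𝔽_l^{⋊±}` ("`Aut_±/Aut_csp ⥲ 𝔽_l^{⋊±}`", [IUTchI] Def 6.1 (v) p. 158).
[claim: Mochizuki2012, status: disputed] -/
theorem lifts_nonempty (g : FlPM l) : (lifts K g).Nonempty := by
  have hσ : K.gChart₀.trans ((FlPM.toPerm l g).trans K.gChart₀.symm) ∈ K.gLabT.autPM := by
    rw [FlPMTorsor.mem_autPM_iff_exists]
    exact ⟨K.gChart₀, K.gChart₀_mem, g, fun t => by simp⟩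
  obtain ⟨b, hb, hbσ⟩ := (K.gLab_range _).mp hσ
  exact ⟨b, (K.mem_autPMg_iff b).mpr hb, hbσ⟩

/-- **Translating the model `Θ^{ell}`-poly-morphisms**: post-composing `φ^{Θell}_{v_z}` with (the image
of) any lift of the translation `c` gives `φ^{Θell}_{v_{z+c}}` ([IUTchI] Ex 6.3 (i) p. 161: `φ^{Θell}_t` is
"the result of post-composing `φ^{Θell}_0` with the poly-action of `t`").
[claim: Mochizuki2012, status: disputed] -/
theorem poly_add (z c : ZMod l) (v : K.V) {b : Aut K.gModel} (hb : b ∈ lifts K (FlPM.transl c)) :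
    poly K (z + c) v = {h | ∃ f ∈ poly K z v, h = f ≫ (K.atV v).map b.hom} := by
  have hmul : FlPM.transl (l := l) c * FlPM.transl z = FlPM.transl (z + c) := by
    ext <;> simp [FlPM.transl, FlPM.mk, add_comm]
  ext h
  constructor
  · rintro ⟨a, ha, b', hb', rfl⟩
    -- `b' = (b' ∘ b⁻¹) ∘ b` with `b' ∘ b⁻¹` a lift of `z`
    have hb'' : b' ≪≫ b.symm ∈ lifts K (FlPM.transl z) := by
      have h := trans_mem_lifts hb' (symm_mem_lifts hb)
      have hg : (FlPM.transl (l := l) c)⁻¹ * FlPM.transl (z + c) = FlPM.transl z := by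
        rw [← hmul, inv_mul_cancel_left]
      simpa only [hg] using h
    refine ⟨a.hom ≫ K.phiEll v ≫ (K.atV v).map (b' ≪≫ b.symm).hom, ⟨a, ha, _, hb'', rfl⟩, ?_⟩
    simp [← Functor.map_comp]
  · rintro ⟨f, ⟨a, ha, b₀, hb₀, rfl⟩, rfl⟩
    refine ⟨a, ha, b₀ ≪≫ b, ?_, by simp [← Functor.map_comp]⟩
    rw [← hmul]
    exact trans_mem_lifts hb₀ hb

/-- Pre-composing a member of `φ^{Θell}_{v_z}` with a positive automorphism of `𝒟_v` gives a member
(`Aut_+(𝒟_{v})` is absorbed, [IUTchI] Ex 6.3 (i) p. 161). [claim: Mochizuki2012, status: disputed] -/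
theorem pre_mem_poly {z : ZMod l} {v : K.V} {a : K.model v ≅ K.model v} (ha : K.labMap v a = Equiv.refl _)
    {f : K.model v ⟶ (K.atV v).obj K.gModel} (hf : f ∈ poly K z v) : a.hom ≫ f ∈ poly K z v := by
  obtain ⟨a₀, ha₀, b, hb, rfl⟩ := hf
  refine ⟨a ≪≫ a₀, ?_, b, hb, by simp⟩
  rw [mem_autPlus_iff, K.labMap_trans, ha, Equiv.refl_trans]
  exact (K.mem_autPlus_iff _).mp ha₀

/-- Post-composing a member of `φ^{Θell}_{v_z}` with (the image of) an element of `Aut_csp(𝒟^{⊚±})` gives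
a member. [claim: Mochizuki2012, status: disputed] -/
theorem post_csp_mem_poly {z : ZMod l} {v : K.V} {c : Aut K.gModel} (hc : c ∈ K.autCsp K.gModel)
    {f : K.model v ⟶ (K.atV v).obj K.gModel} (hf : f ∈ poly K z v) :
    f ≫ (K.atV v).map c.hom ∈ poly K z v := by
  obtain ⟨a₀, ha₀, b, hb, rfl⟩ := hf
  exact ⟨a₀, ha₀, b ≪≫ c, trans_csp_mem_lifts hb hc, by simp [← Functor.map_comp]⟩

end Ex63

/-! ### The two sides of the compatibility square of an isomorphism of `𝒟-Θ^{ell}`-bridges -/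

/-- **Capsule side.** Pre-composing the conjugate `ellConj a₂ β (φ^{Θell}_{v_w})` with the `+`-full
poly-isomorphism through `a₁⁻¹ ∘ a₂` gives the conjugate by `a₁`: `Aut_+` is absorbed ([IUTchI] Def 6.4
(ii) p. 163, compatibility "with `†φ^{Θell}_±`, `‡φ^{Θell}_±`"). [claim: Mochizuki2012, status: disputed] -/
theorem ellConj_capsule_side {C₁ C₂ : K.DStrip} {G : K.Glob} (a₁ : (DStrip.model K).Iso C₁)
    (a₂ : (DStrip.model K).Iso C₂) (β : K.gModel ≅ G) (w : ZMod l) (v : K.V) :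
    {h | ∃ p ∈ DStrip.plusFullPolyIso (a₁.symm.trans a₂), ∃ g ∈ K.ellConj a₂ β v (Ex63.poly K w v),
      h = (p v).hom ≫ g} = K.ellConj a₁ β v (Ex63.poly K w v) := by
  ext h
  constructor
  · rintro ⟨p, hp, g, ⟨f, hf, rfl⟩, rfl⟩
    rw [DStrip.mem_plusFullPolyIso_iff] at hp
    -- `p v = a₁⁻¹ ∘ a₂ ∘ (positive)`; move the positive part onto the model object
    have hpos : K.labMap v (a₂ v ≪≫ ((a₁ v).symm ≪≫ a₂ v).symm ≪≫ p v ≪≫ (a₂ v).symm) = Equiv.refl _ := by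
      rw [K.labMap_trans, K.labMap_trans, K.labMap_trans, labMap_symm, labMap_symm, hp v]
      change (K.labMap v (a₂ v)).trans ((K.labMap v ((a₁ v).symm ≪≫ a₂ v)).symm.trans
        ((K.labMap v ((a₁ v).symm ≪≫ a₂ v)).trans (K.labMap v (a₂ v)).symm)) = Equiv.refl _
      ext x
      simp
    refine ⟨_, Ex63.pre_mem_poly hpos hf, ?_⟩
    change (p v).hom ≫ (a₂ v).inv ≫ f ≫ (K.atV v).map β.hom =
      (a₁ v).inv ≫ ((a₂ v ≪≫ ((a₁ v).symm ≪≫ a₂ v).symm ≪≫ p v ≪≫ (a₂ v).symm).hom ≫ f) ≫ (K.atV v).map β.hom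
    simp
  · rintro ⟨f, hf, rfl⟩
    refine ⟨a₁.symm.trans a₂, DStrip.self_mem_plusFullPolyIso _, (a₂ v).inv ≫ f ≫ (K.atV v).map β.hom,
      ⟨f, hf, rfl⟩, ?_⟩
    change (a₁ v).inv ≫ f ≫ (K.atV v).map β.hom = ((a₁ v).symm ≪≫ a₂ v).hom ≫ (a₂ v).inv ≫ f ≫ _
    simp

/-- `Aut_csp` is transported by isomorphisms of global objects (functoriality of `LabCusp^±`).
[claim: Mochizuki2012, status: disputed] -/
theorem conj_mem_autCsp {G H : K.Glob} (β : G ≅ H) {c : Aut H} (hc : c ∈ K.autCsp H) :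
    (β ≪≫ c ≪≫ β.symm : Aut G) ∈ K.autCsp G := by
  have hc' : K.gLabMap c = Equiv.refl _ := MonoidHom.mem_ker.mp hc
  show K.gLabMap (β ≪≫ c ≪≫ β.symm) = Equiv.refl _
  rw [K.gLabMap_trans, K.gLabMap_trans, hc', Equiv.refl_trans, ← K.gLabMap_trans, Iso.self_symm_id,
    K.gLabMap_refl]

/-- **Global side.** Post-composing the conjugate `ellConj a β₁ (φ^{Θell}_{v_z})` with the
`Aut_csp(‡𝒟^{⊚±})`-orbit of `β₁⁻¹ ∘ b ∘ β₂`, `b` a lift of the translation `c`, gives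
`ellConj a β₂ (φ^{Θell}_{v_{z+c}})` ([IUTchI] Ex 6.3 (i)/(ii) p. 161; Def 6.4 (ii) p. 163).
[claim: Mochizuki2012, status: disputed] -/
theorem ellConj_global_side {C : K.DStrip} {G₁ G₂ : K.Glob} (a : (DStrip.model K).Iso C)
    (β₁ : K.gModel ≅ G₁) (β₂ : K.gModel ≅ G₂) (z c : ZMod l) (v : K.V) {b : Aut K.gModel}
    (hb : b ∈ Ex63.lifts K (FlPM.transl c)) :
    {h | ∃ f ∈ K.ellConj a β₁ v (Ex63.poly K z v),
      ∃ q ∈ {ψ : G₁ ≅ G₂ | ∃ c' ∈ K.autCsp G₂, ψ = (β₁.symm ≪≫ b ≪≫ β₂) ≪≫ c'},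
        h = f ≫ (K.atV v).map (q : G₁ ≅ G₂).hom} = K.ellConj a β₂ v (Ex63.poly K (z + c) v) := by
  ext h
  constructor
  · rintro ⟨f, ⟨f₀, hf₀, rfl⟩, q, ⟨c', hc', rfl⟩, rfl⟩
    obtain ⟨c', rfl⟩ : ∃ c'' : G₂ ≅ G₂, c'' = c' := ⟨c', rfl⟩
    have hc'' : (β₂ ≪≫ c' ≪≫ β₂.symm : Aut K.gModel) ∈ K.autCsp K.gModel := conj_mem_autCsp β₂ hc'
    have hmem : (f₀ ≫ (K.atV v).map b.hom) ≫ (K.atV v).map (β₂ ≪≫ c' ≪≫ β₂.symm).hom ∈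
        Ex63.poly K (z + c) v :=
      Ex63.post_csp_mem_poly hc'' (by rw [Ex63.poly_add z c v hb]; exact ⟨f₀, hf₀, rfl⟩)
    refine ⟨_, hmem, ?_⟩
    simp [← Functor.map_comp]
  · rintro ⟨f', hf', rfl⟩
    rw [Ex63.poly_add z c v hb] at hf'
    obtain ⟨f₀, hf₀, rfl⟩ := hf'
    refine ⟨(a v).inv ≫ f₀ ≫ (K.atV v).map β₁.hom, ⟨f₀, hf₀, rfl⟩, (β₁.symm ≪≫ b ≪≫ β₂) ≪≫ Iso.refl _,
      ⟨1, one_mem _, rfl⟩, ?_⟩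
    change (a v).inv ≫ (f₀ ≫ (K.atV v).map b.hom) ≫ (K.atV v).map β₂.hom = _
    simp [← Functor.map_comp]

/-! ### Isomorphisms of `𝒟-Θ^{ell}`-bridges with prescribed translation -/

namespace DThetaEllBridge

/-- **Translations act**: for `𝒟-Θ^{ell}`-bridges exhibited by `(ι₁, α₁, β₁)`, `(ι₂, α₂, β₂)` and any
`c ∈ 𝔽_l`, there is an isomorphism of `𝒟-Θ^{ell}`-bridges whose index bijection is `ι₂ ∘ (· + c) ∘ ι₁⁻¹`
— the positive (translation) part of the `𝔽_l^{⋊±}`-symmetry of [IUTchI] Example 6.3 (ii) p. 161 /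
Prop 6.6 (ii) p. 165 / Prop 6.8 (i) p. 168, transported to arbitrary bridges.
[claim: Mochizuki2012, status: disputed] -/
theorem Iso.exists_transl (B₁ B₂ : K.DThetaEllBridge)
    {ι₁ : ZMod l ≃ B₁.T} (hι₁ : ∀ e ∈ B₁.torT.charts, ι₁.trans e ∈ (FlPMTorsor.tautological l).charts)
    {α₁ : ∀ z, (DStrip.model K).Iso (B₁.capsule (ι₁ z))} {β₁ : K.gModel ≅ B₁.glob}
    (h₁ : ∀ z v, B₁.poly (ι₁ z) v = K.ellConj (α₁ z) β₁ v (Ex63.poly K z v))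
    {ι₂ : ZMod l ≃ B₂.T} (hι₂ : ∀ e ∈ B₂.torT.charts, ι₂.trans e ∈ (FlPMTorsor.tautological l).charts)
    {α₂ : ∀ z, (DStrip.model K).Iso (B₂.capsule (ι₂ z))} {β₂ : K.gModel ≅ B₂.glob}
    (h₂ : ∀ z v, B₂.poly (ι₂ z) v = K.ellConj (α₂ z) β₂ v (Ex63.poly K z v)) (c : ZMod l) :
    ∃ g : Iso B₁ B₂, g.indexEquiv = ι₁.symm.trans ((Equiv.addRight c).trans ι₂) := by
  obtain ⟨b, hb⟩ := Ex63.lifts_nonempty (K := K) (FlPM.transl c)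
  -- `α₁` transported to arbitrary indices `t` (a cast along `ι₁ (ι₁⁻¹ t) = t`)
  let α₁' : ∀ t : B₁.T, (DStrip.model K).Iso (B₁.capsule t) := fun t v =>
    α₁ (ι₁.symm t) v ≪≫ eqToIso (congrArg (fun s => (B₁.capsule s).obj v) (ι₁.apply_symm_apply t))
  have hα₁' : ∀ z, α₁' (ι₁ z) = α₁ z := fun z =>
    DStrip.isoCast_eq (fun s => B₁.capsule (ι₁ s)) _ α₁ (ι₁.symm_apply_apply z)
  refine ⟨{ indexEquiv := ι₁.symm.trans ((Equiv.addRight c).trans ι₂)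
            indexEquiv_charts := fun e he => ?_
            capsPoly := fun t => DStrip.plusFullPolyIso ((α₁' t).symm.trans (α₂ (ι₁.symm t + c)))
            capsPoly_plusFull := fun t => ⟨_, rfl⟩
            globPoly := {ψ | ∃ c' ∈ K.autCsp B₂.glob, ψ = (β₁.symm ≪≫ b ≪≫ β₂) ≪≫ c'}
            globPoly_orbit := ⟨_, rfl⟩
            compat := fun t v => ?_ }, rfl⟩
  · -- the index bijection is an isomorphism of `𝔽_l^±`-torsors
    rw [Equiv.trans_assoc, Equiv.trans_assoc]
    exact B₁.torT.symm_trans_mem_of_compat hι₁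
      (FlPMTorsor.addRight_trans_mem_tautological c (hι₂ e he))
  · -- compatibility with `†φ^{Θell}_±`, `‡φ^{Θell}_±`, at `t = ι₁ z`
    obtain ⟨z, rfl⟩ := ι₁.surjective t
    change {h | ∃ p ∈ DStrip.plusFullPolyIso ((α₁' (ι₁ z)).symm.trans (α₂ (ι₁.symm (ι₁ z) + c))),
        ∃ g ∈ B₂.poly (ι₂ (ι₁.symm (ι₁ z) + c)) v, h = (p v).hom ≫ g} =
      {h | ∃ f ∈ B₁.poly (ι₁ z) v,
        ∃ q ∈ {ψ : B₁.glob ≅ B₂.glob | ∃ c' ∈ K.autCsp B₂.glob, ψ = (β₁.symm ≪≫ b ≪≫ β₂) ≪≫ c'},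
          h = f ≫ (K.atV v).map (q : B₁.glob ≅ B₂.glob).hom}
    rw [hα₁', h₂, h₁, ellConj_capsule_side, ellConj_global_side (α₁ z) β₁ β₂ z c v hb,
      Equiv.symm_apply_apply]

/-- **[IUTchI] Prop 6.6 (ii), first clause — DISCHARGED**: between any two `𝒟-Θ^{ell}`-bridges there is
an isomorphism (the first conjunct `Nonempty (Iso B₁ B₂)` of the named statement
`DThetaEllBridge.IsoTorsor`). [claim: Mochizuki2012, status: disputed] -/
theorem isoTorsor_nonempty (B₁ B₂ : K.DThetaEllBridge) : Nonempty (Iso B₁ B₂) := by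
  obtain ⟨ι₁, hι₁, α₁, β₁, h₁⟩ := B₁.exists_model
  obtain ⟨ι₂, hι₂, α₂, β₂, h₂⟩ := B₂.exists_model
  obtain ⟨g, -⟩ := Iso.exists_transl B₁ B₂ hι₁ h₁ hι₂ h₂ 0
  exact ⟨g⟩

end DThetaEllBridge

/-! ### Proposition 6.8 (i): transitivity on the index set -/

namespace DThetaPMEllHT

/-- **[IUTchI] Prop 6.8 (i), transitivity clause — DISCHARGED**: the automorphisms of the underlying
`𝒟-Θ^{ell}`-bridge of a `𝒟-Θ^{±ell}`-Hodge theater act transitively on the index set `T` through their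
index bijections (the first conjunct of the named statement `EllBridgeSymmetry`; "a symmetry … which acts
doubly transitively", p. 168 — the translations already act transitively).
[claim: Mochizuki2012, status: disputed] -/
theorem ellBridgeSymmetry_transitive (H : K.DThetaPMEllHT) (t₁ t₂ : H.T) :
    ∃ g : DThetaEllBridge.Iso H.ellBridge H.ellBridge, g.indexEquiv t₁ = t₂ := by
  obtain ⟨ι, hι, α, β, h⟩ := H.ellBridge.exists_model
  obtain ⟨g, hg⟩ := DThetaEllBridge.Iso.exists_transl H.ellBridge H.ellBridge hι h hι h (ι.symm t₂ - ι.symm t₁)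
  refine ⟨g, ?_⟩
  rw [hg]
  simp

end DThetaPMEllHT

end PMBaseKit

end Literature.IUT.HodgeTheaters
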